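import Mathlib
import HarnessLib
import Summits.ResolutionOfSingularities.ResolutionOfSingularities.Theorems.WildQuotientsWildQuotientResolutionS1aA1Move2Cover

/-!
# S1a — INSTANCE I-2 (a1), MOVE 3 (THE KILL): the σ-fixed degree-0 cover of `B₊(s₂, Y₂, s)`, `hrad`, and «every cover element lies in 𝔞₃»

[OURS · L1 W4.5c · lead-1 g13; plan-1 CHAIN v10.40 §4 ASSIGNMENT (iii), R-F15c (I-2 := MT-a1″, move 3 on `[X₀]₂`: centre `(s₂:1, Y₂:1, s:2)`, three
producer charts ALL KILLED), X-CERT v1 §3 a1 move 3] — NOT statements of the manuscript; counted 0; AI-level work, weaker than expert review. Crux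
stmt-ResolutionOfSingularities-17941 `CyclicQuotientFourfolds`, line `s1a-logminvertex` v13 (`stub_reachLowerInFX`). Pure commutative algebra on the
abstract model `Q` of the node of `[X₀]₂` (generators `s₂, Y₀, X₁, Y₂, x₃, s`, fixed units `η⁻¹`, `κ = c₀⁻¹`; rows as in `…S1aA1Move3Ring`).

With `D₂ = d₂·d·2p` (the degree of move 2's cover) the three RAW cover elements of move 3 are
`b₀ = s₂^{2dp}·Y₀^{dp}·η⁻¹ ∈ 𝒥_{2dp}`, `b₁ = N₃^{2dd₂}·κ ∈ 𝒥_{D₂}` (`N₃ = ∏_{i : ZMod p} (Y₂ + i·s²Y₀s₂) = ∏ σⁱ(Y₂)`), `b₂ = s^{D₂}·Y₀^{d₂dp}·κ ∈ 𝒥_{2D₂}`,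
all `τ`-FIXED and of DEGREE 0 for the node grading (degrees `s₂ ↦ −θ₂`, `Y₂ ↦ θ₂`, `Y₀ ↦ 2θ₂ + 2θ₁`, `s ↦ −θ₁`, `η⁻¹ ↦ −2dp·θ₁`, `κ ↦ −D₂·θ₂`); the cover in
the common degree `d₃·(2D₂)` is `y₀ = b₀^{2d₂d₃}`, `y₁ = b₁^{2d₃}`, `y₂ = b₂^{d₃}`:
* `a1m3_hf`, `a1m3_b₀/b₁/b₂_mem/_fixed/_deg`, `a1m3_y₀/y₁/y₂_mem/_fixed/_deg` — filtration level, `τ`-fixedness, degree 0;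
* ★ `a1m3_hrad` — `s₂T, Y₂T, sT² ∈ √(c₀, c₁, c₂)` for `c_j = y_jT^{d₃·2D₂}` (`Y₀, η⁻¹, κ` units): the three charts cover `B₊`;
* ★ `a1m3_cover_mem_ideal` — EVERY `c_j` lies in any ideal of `R₃` containing `s₂′·Y₀`, `X₁·Y₂′`, `Y₀·s′` (`X₁` a unit) — with ✓`a1m3_residual_mem` every
  cover element lies in the residual ideal `𝔞₃`, so on every producer chart of move 3 the residual section `c_j·c_j⁻¹ = 1` kills the chart (X-CERT v1 §3:
  a1 depth 3, all leaves killed).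
-/

set_option linter.dupNamespace false

noncomputable section

open Literature.AlgebraicGeometry.Resolution
open scoped LaurentPolynomial
open Summit.ResolutionOfSingularities.ResolutionOfSingularities.Theorems.WildQuotientResolution.S1.CoarseChart
open Summit.ResolutionOfSingularities.ResolutionOfSingularities.Theorems.WildQuotientResolution.S1.BlowupCharts
open Summit.ResolutionOfSingularities.ResolutionOfSingularities.Theorems.WildQuotientResolution.S1.ReesBigrading

namespace Summit.ResolutionOfSingularities.ResolutionOfSingularities.Theorems.WildQuotientResolution.S1.KillCert.A1

variable {Q : Type} [CommRing Q] (τ : Q ≃+* Q) (s₂ Y₀ X₁ Y₂ x₃ s ηinv κ : Q)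
  (hs₂ : τ s₂ = s₂) (hY₀ : τ Y₀ = Y₀) (hY₂ : τ Y₂ = Y₂ + s ^ 2 * Y₀ * s₂) (hs : τ s = s) (hηinv : τ ηinv = ηinv) (hκ : τ κ = κ)
  {p : ℕ} (d d₂ d₃ : ℕ)

/-! ## Filtration levels of the raw cover elements -/

/-- `N₃ = ∏ (Y₂ + i·s²Y₀s₂) ∈ 𝒥_p`. -/
theorem a1m3_norm_mem [NeZero p] :
    (∏ i : ZMod p, (Y₂ + (i.val : Q) * (s ^ 2 * Y₀ * s₂))) ∈ (weightedFiltration (![s₂, Y₂, s] : Fin 3 → Q) ![1, 1, 2]).ideal p := by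
  have h1 : ∀ i : ZMod p, Y₂ + (i.val : Q) * (s ^ 2 * Y₀ * s₂) ∈ (weightedFiltration (![s₂, Y₂, s] : Fin 3 → Q) ![1, 1, 2]).ideal 1 := fun i =>
    add_mem (mem_weightedFiltration_ideal (![s₂, Y₂, s] : Fin 3 → Q) ![1, 1, 2] 1)
      (Ideal.mul_mem_left _ _ (Ideal.mul_mem_left _ _ (mem_weightedFiltration_ideal (![s₂, Y₂, s] : Fin 3 → Q) ![1, 1, 2] 0)))
  have := Ideal.prod_mem_prod (s := (Finset.univ : Finset (ZMod p))) (fun i _ => h1 i)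
  rw [Finset.prod_const, Finset.card_univ, ZMod.card] at this
  have hle := Veronese.idealFiltration_pow_le (weightedFiltration (![s₂, Y₂, s] : Fin 3 → Q) ![1, 1, 2]) 1 p
  rw [one_mul] at hle
  exact hle this

/-- `b₀ = s₂^{2dp}·(Y₀^{dp}η⁻¹) ∈ 𝒥_{2dp}`. -/
theorem a1m3_b₀_mem : s₂ ^ (2 * (d * p)) * (Y₀ ^ (d * p) * ηinv) ∈ (weightedFiltration (![s₂, Y₂, s] : Fin 3 → Q) ![1, 1, 2]).ideal (2 * (d * p)) := by
  refine Ideal.mul_mem_right _ _ ?_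
  have h := Ideal.pow_mem_pow (mem_weightedFiltration_ideal (![s₂, Y₂, s] : Fin 3 → Q) ![1, 1, 2] 0) (2 * (d * p))
  have hle := Veronese.idealFiltration_pow_le (weightedFiltration (![s₂, Y₂, s] : Fin 3 → Q) ![1, 1, 2]) 1 (2 * (d * p))
  rw [one_mul] at hle
  exact hle h

/-- `b₁ = N₃^{2dd₂}·κ ∈ 𝒥_{D₂}`, `D₂ = d₂·d·2p`. -/
theorem a1m3_b₁_mem [NeZero p] :
    (∏ i : ZMod p, (Y₂ + (i.val : Q) * (s ^ 2 * Y₀ * s₂))) ^ (2 * d * d₂) * κ ∈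
      (weightedFiltration (![s₂, Y₂, s] : Fin 3 → Q) ![1, 1, 2]).ideal (d₂ * (d * (2 * p))) := by
  refine Ideal.mul_mem_right _ _ ?_
  have h := Ideal.pow_mem_pow (a1m3_norm_mem s₂ Y₀ Y₂ s (p := p)) (2 * d * d₂)
  have hle := Veronese.idealFiltration_pow_le (weightedFiltration (![s₂, Y₂, s] : Fin 3 → Q) ![1, 1, 2]) p (2 * d * d₂)
  have e1 : p * (2 * d * d₂) = d₂ * (d * (2 * p)) := by ring
  rw [e1] at hle
  exact hle h

/-- `b₂ = s^{D₂}·(Y₀^{d₂dp}κ) ∈ 𝒥_{2D₂}`. -/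
theorem a1m3_b₂_mem :
    s ^ (d₂ * (d * (2 * p))) * (Y₀ ^ (d₂ * (d * p)) * κ) ∈ (weightedFiltration (![s₂, Y₂, s] : Fin 3 → Q) ![1, 1, 2]).ideal (2 * (d₂ * (d * (2 * p)))) := by
  refine Ideal.mul_mem_right _ _ ?_
  have h := Ideal.pow_mem_pow (mem_weightedFiltration_ideal (![s₂, Y₂, s] : Fin 3 → Q) ![1, 1, 2] 2) (d₂ * (d * (2 * p)))
  have hle := Veronese.idealFiltration_pow_le (weightedFiltration (![s₂, Y₂, s] : Fin 3 → Q) ![1, 1, 2]) 2 (d₂ * (d * (2 * p)))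
  exact hle h

/-- **The cover in the common degree `d₃·2D₂`**: `y₀ = b₀^{2d₂d₃}`, `y₁ = b₁^{2d₃}`, `y₂ = b₂^{d₃}` all lie in `𝒥_{d₃·(2D₂)}`. -/
theorem a1m3_y_mem [NeZero p] :
    (s₂ ^ (2 * (d * p)) * (Y₀ ^ (d * p) * ηinv)) ^ (2 * d₂ * d₃) ∈ (weightedFiltration (![s₂, Y₂, s] : Fin 3 → Q) ![1, 1, 2]).ideal (d₃ * (2 * (d₂ * (d * (2 * p))))) ∧
    ((∏ i : ZMod p, (Y₂ + (i.val : Q) * (s ^ 2 * Y₀ * s₂))) ^ (2 * d * d₂) * κ) ^ (2 * d₃) ∈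
      (weightedFiltration (![s₂, Y₂, s] : Fin 3 → Q) ![1, 1, 2]).ideal (d₃ * (2 * (d₂ * (d * (2 * p))))) ∧
    (s ^ (d₂ * (d * (2 * p))) * (Y₀ ^ (d₂ * (d * p)) * κ)) ^ d₃ ∈ (weightedFiltration (![s₂, Y₂, s] : Fin 3 → Q) ![1, 1, 2]).ideal (d₃ * (2 * (d₂ * (d * (2 * p))))) := by
  refine ⟨?_, ?_, ?_⟩
  · have h := Ideal.pow_mem_pow (a1m3_b₀_mem s₂ Y₀ Y₂ s ηinv (p := p) d) (2 * d₂ * d₃)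
    have hle := Veronese.idealFiltration_pow_le (weightedFiltration (![s₂, Y₂, s] : Fin 3 → Q) ![1, 1, 2]) (2 * (d * p)) (2 * d₂ * d₃)
    have e1 : 2 * (d * p) * (2 * d₂ * d₃) = d₃ * (2 * (d₂ * (d * (2 * p)))) := by ring
    rw [e1] at hle
    exact hle h
  · have h := Ideal.pow_mem_pow (a1m3_b₁_mem s₂ Y₀ Y₂ s κ (p := p) d d₂) (2 * d₃)
    have hle := Veronese.idealFiltration_pow_le (weightedFiltration (![s₂, Y₂, s] : Fin 3 → Q) ![1, 1, 2]) (d₂ * (d * (2 * p))) (2 * d₃)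
    have e1 : d₂ * (d * (2 * p)) * (2 * d₃) = d₃ * (2 * (d₂ * (d * (2 * p)))) := by ring
    rw [e1] at hle
    exact hle h
  · have h := Ideal.pow_mem_pow (a1m3_b₂_mem s₂ Y₀ Y₂ s κ (p := p) d d₂) d₃
    have hle := Veronese.idealFiltration_pow_le (weightedFiltration (![s₂, Y₂, s] : Fin 3 → Q) ![1, 1, 2]) (2 * (d₂ * (d * (2 * p)))) d₃
    have e1 : 2 * (d₂ * (d * (2 * p))) * d₃ = d₃ * (2 * (d₂ * (d * (2 * p)))) := by ring
    rw [e1] at hle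
    exact hle h

/-! ## `τ`-fixedness -/

include hs₂ hY₀ hY₂ hs in
/-- `τ N₃ = N₃`. -/
theorem a1m3_norm_fixed [NeZero p] [CharP Q p] (hp1 : p ≠ 1) :
    τ (∏ i : ZMod p, (Y₂ + (i.val : Q) * (s ^ 2 * Y₀ * s₂))) = ∏ i : ZMod p, (Y₂ + (i.val : Q) * (s ^ 2 * Y₀ * s₂)) :=
  prod_shift_fixed hp1 τ Y₂ (s ^ 2 * Y₀ * s₂) hY₂ (by rw [map_mul, map_mul, map_pow, hs, hY₀, hs₂])

include hs₂ hY₀ hY₂ hs hηinv hκ in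
/-- **The cover is `τ`-fixed.** -/
theorem a1m3_y_fixed [NeZero p] [CharP Q p] (hp1 : p ≠ 1) :
    τ ((s₂ ^ (2 * (d * p)) * (Y₀ ^ (d * p) * ηinv)) ^ (2 * d₂ * d₃)) = (s₂ ^ (2 * (d * p)) * (Y₀ ^ (d * p) * ηinv)) ^ (2 * d₂ * d₃) ∧
    τ (((∏ i : ZMod p, (Y₂ + (i.val : Q) * (s ^ 2 * Y₀ * s₂))) ^ (2 * d * d₂) * κ) ^ (2 * d₃)) =
      ((∏ i : ZMod p, (Y₂ + (i.val : Q) * (s ^ 2 * Y₀ * s₂))) ^ (2 * d * d₂) * κ) ^ (2 * d₃) ∧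
    τ ((s ^ (d₂ * (d * (2 * p))) * (Y₀ ^ (d₂ * (d * p)) * κ)) ^ d₃) = (s ^ (d₂ * (d * (2 * p))) * (Y₀ ^ (d₂ * (d * p)) * κ)) ^ d₃ := by
  refine ⟨?_, ?_, ?_⟩
  · rw [map_pow, map_mul, map_pow, map_mul, map_pow, hs₂, hY₀, hηinv]
  · rw [map_pow, map_mul, map_pow, a1m3_norm_fixed τ s₂ Y₀ Y₂ s hs₂ hY₀ hY₂ hs hp1, hκ]
  · rw [map_pow, map_mul, map_pow, map_mul, map_pow, hs, hY₀, hκ]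

/-! ## Degrees -/

section Degrees

variable {m : ℕ} (r : Fin m → ℕ) (𝒜 : (Π j : Fin m, ZMod (r j)) → AddSubgroup Q) [GradedRing 𝒜] (θ₁ θ₂ : Π j : Fin m, ZMod (r j))
  (hs₂d : s₂ ∈ 𝒜 (-θ₂)) (hY₀d : Y₀ ∈ 𝒜 (2 • θ₂ + 2 • θ₁)) (hY₂d : Y₂ ∈ 𝒜 θ₂) (hsd : s ∈ 𝒜 (-θ₁))
  (hηinvd : ηinv ∈ 𝒜 (-((d * (2 * p)) • θ₁))) (hκd : κ ∈ 𝒜 (-((d₂ * (d * (2 * p))) • θ₂)))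

omit [GradedRing 𝒜] in
include hs₂d hY₂d hsd in
/-- The centre `(s₂, Y₂, s)` is homogeneous of degrees `(−θ₂, θ₂, −θ₁)`. -/
theorem a1m3_hf (i : Fin 3) : (![s₂, Y₂, s] : Fin 3 → Q) i ∈ 𝒜 ((![-θ₂, θ₂, -θ₁] : Fin 3 → Π j : Fin m, ZMod (r j)) i) := by
  fin_cases i
  · exact hs₂d
  · exact hY₂d
  · exact hsd

include hs₂d hY₀d hsd in
/-- `s²Y₀s₂` has degree `θ₂`. -/
theorem a1m3_shift_deg : s ^ 2 * Y₀ * s₂ ∈ 𝒜 θ₂ := by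
  have h := SetLike.mul_mem_graded (SetLike.mul_mem_graded (SetLike.pow_mem_graded 2 hsd) hY₀d) hs₂d
  have e1 : 2 • (-θ₁) + (2 • θ₂ + 2 • θ₁) + -θ₂ = θ₂ := by
    simp only [smul_neg, two_nsmul]; abel
  rwa [e1] at h

include hs₂d hY₀d hY₂d hsd in
/-- `N₃` has degree `p • θ₂`. -/
theorem a1m3_norm_deg [NeZero p] : (∏ i : ZMod p, (Y₂ + (i.val : Q) * (s ^ 2 * Y₀ * s₂))) ∈ 𝒜 (p • θ₂) := by
  have hfac : ∀ i : ZMod p, Y₂ + (i.val : Q) * (s ^ 2 * Y₀ * s₂) ∈ 𝒜 θ₂ := by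
    intro i
    refine add_mem hY₂d ?_
    have hn : ((i.val : Q)) ∈ 𝒜 0 := SetLike.natCast_mem_graded _ _
    have := SetLike.mul_mem_graded hn (a1m3_shift_deg s₂ Y₀ s r 𝒜 θ₁ θ₂ hs₂d hY₀d hsd)
    rwa [zero_add] at this
  have h := SetLike.prod_mem_graded (A := 𝒜) (i := fun _ => θ₂) (g := fun i => Y₂ + (i.val : Q) * (s ^ 2 * Y₀ * s₂))
    (F := Finset.univ) (fun i _ => hfac i)
  rwa [Finset.sum_const, Finset.card_univ, ZMod.card] at h

include hs₂d hY₀d hηinvd in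
/-- `b₀` has degree 0. -/
theorem a1m3_b₀_deg : s₂ ^ (2 * (d * p)) * (Y₀ ^ (d * p) * ηinv) ∈ 𝒜 0 := by
  have h := SetLike.mul_mem_graded (SetLike.pow_mem_graded (2 * (d * p)) hs₂d) (SetLike.mul_mem_graded (SetLike.pow_mem_graded (d * p) hY₀d) hηinvd)
  have e1 : (2 * (d * p)) • (-θ₂) + ((d * p) • (2 • θ₂ + 2 • θ₁) + -((d * (2 * p)) • θ₁)) = 0 := by
    rw [smul_neg, smul_add, ← mul_nsmul', ← mul_nsmul', show d * p * 2 = 2 * (d * p) by ring, show d * (2 * p) = 2 * (d * p) by ring]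
    abel
  rwa [e1] at h

include hs₂d hY₀d hY₂d hsd hκd in
/-- `b₁` has degree 0. -/
theorem a1m3_b₁_deg [NeZero p] : (∏ i : ZMod p, (Y₂ + (i.val : Q) * (s ^ 2 * Y₀ * s₂))) ^ (2 * d * d₂) * κ ∈ 𝒜 0 := by
  have h := SetLike.mul_mem_graded (SetLike.pow_mem_graded (2 * d * d₂) (a1m3_norm_deg s₂ Y₀ Y₂ s (p := p) r 𝒜 θ₁ θ₂ hs₂d hY₀d hY₂d hsd)) hκd
  have e1 : (2 * d * d₂) • (p • θ₂) + -((d₂ * (d * (2 * p))) • θ₂) = 0 := by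
    rw [← mul_nsmul', show 2 * d * d₂ * p = d₂ * (d * (2 * p)) by ring, add_neg_cancel]
  rwa [e1] at h

include hY₀d hsd hκd in
/-- `b₂` has degree 0. -/
theorem a1m3_b₂_deg : s ^ (d₂ * (d * (2 * p))) * (Y₀ ^ (d₂ * (d * p)) * κ) ∈ 𝒜 0 := by
  have h := SetLike.mul_mem_graded (SetLike.pow_mem_graded (d₂ * (d * (2 * p))) hsd) (SetLike.mul_mem_graded (SetLike.pow_mem_graded (d₂ * (d * p)) hY₀d) hκd)
  have e1 : (d₂ * (d * (2 * p))) • (-θ₁) + ((d₂ * (d * p)) • (2 • θ₂ + 2 • θ₁) + -((d₂ * (d * (2 * p))) • θ₂)) = 0 := by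
    rw [smul_neg, smul_add, ← mul_nsmul', ← mul_nsmul', show d₂ * (d * p) * 2 = d₂ * (d * (2 * p)) by ring]
    abel
  rwa [e1] at h

include hs₂d hY₀d hY₂d hsd hηinvd hκd in
/-- **The cover has degree 0.** -/
theorem a1m3_y_deg [NeZero p] :
    (s₂ ^ (2 * (d * p)) * (Y₀ ^ (d * p) * ηinv)) ^ (2 * d₂ * d₃) ∈ 𝒜 0 ∧
    ((∏ i : ZMod p, (Y₂ + (i.val : Q) * (s ^ 2 * Y₀ * s₂))) ^ (2 * d * d₂) * κ) ^ (2 * d₃) ∈ 𝒜 0 ∧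
    (s ^ (d₂ * (d * (2 * p))) * (Y₀ ^ (d₂ * (d * p)) * κ)) ^ d₃ ∈ 𝒜 0 := by
  refine ⟨?_, ?_, ?_⟩
  · have h := SetLike.pow_mem_graded (2 * d₂ * d₃) (a1m3_b₀_deg s₂ Y₀ ηinv (p := p) d r 𝒜 θ₁ θ₂ hs₂d hY₀d hηinvd)
    rwa [smul_zero] at h
  · have h := SetLike.pow_mem_graded (2 * d₃) (a1m3_b₁_deg s₂ Y₀ Y₂ s κ (p := p) d d₂ r 𝒜 θ₁ θ₂ hs₂d hY₀d hY₂d hsd hκd)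
    rwa [smul_zero] at h
  · have h := SetLike.pow_mem_graded d₃ (a1m3_b₂_deg Y₀ s κ (p := p) d d₂ r 𝒜 θ₁ θ₂ hY₀d hsd hκd)
    rwa [smul_zero] at h

end Degrees

/-! ## `hrad` and «every cover element lies in 𝔞₃» in `R₃ = R^w(Q; s₂, Y₂, s)` -/

/-- `N₃·T^p = ∏ (Y₂T + i·s²Y₀·(s₂T))` in `Q[T;T⁻¹]`. -/
theorem a1m3_norm_T [NeZero p] : LaurentPolynomial.C (∏ i : ZMod p, (Y₂ + (i.val : Q) * (s ^ 2 * Y₀ * s₂))) * LaurentPolynomial.T (p : ℤ) =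
    ∏ i : ZMod p, (LaurentPolynomial.C Y₂ * LaurentPolynomial.T 1 +
      LaurentPolynomial.C ((i.val : Q) * (s ^ 2 * Y₀)) * (LaurentPolynomial.C s₂ * LaurentPolynomial.T 1)) := by
  have hfac : ∀ i : ZMod p, LaurentPolynomial.C Y₂ * LaurentPolynomial.T 1 +
      LaurentPolynomial.C ((i.val : Q) * (s ^ 2 * Y₀)) * (LaurentPolynomial.C s₂ * LaurentPolynomial.T 1) =
      LaurentPolynomial.C (Y₂ + (i.val : Q) * (s ^ 2 * Y₀ * s₂)) * LaurentPolynomial.T 1 := by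
    intro i
    simp only [map_add, map_mul, map_pow]
    ring
  simp_rw [hfac]
  rw [Finset.prod_mul_distrib, ← map_prod, Finset.prod_const, Finset.card_univ, ZMod.card, LaurentPolynomial.T_pow, mul_one]

/-- The three raw cover elements as products in `R₃`: `(s₂T)^{2dp}·(Y₀^{dp}η⁻¹) = b₀T^{2dp}`, `(∏(Y₂T + i s²Y₀·s₂T))^{2dd₂}·κ = b₁T^{D₂}`,
`(sT²)^{D₂}·(Y₀^{d₂dp}κ) = b₂T^{2D₂}`. -/
theorem a1m3_raw_coe [NeZero p] :
    (((cobordantAlgebra.u' (![s₂, Y₂, s] : Fin 3 → Q) ![1, 1, 2] 0 ^ (2 * (d * p)) * algebraMap Q _ (Y₀ ^ (d * p) * ηinv) :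
        ↥(cobordantAlgebra (![s₂, Y₂, s] : Fin 3 → Q) ![1, 1, 2])) : Q[T;T⁻¹]) =
      LaurentPolynomial.C (s₂ ^ (2 * (d * p)) * (Y₀ ^ (d * p) * ηinv)) * LaurentPolynomial.T (((2 * (d * p)) : ℕ) : ℤ)) ∧
    ((((∏ i : ZMod p, (cobordantAlgebra.u' (![s₂, Y₂, s] : Fin 3 → Q) ![1, 1, 2] 1 +
        algebraMap Q _ ((i.val : Q) * (s ^ 2 * Y₀)) * cobordantAlgebra.u' (![s₂, Y₂, s] : Fin 3 → Q) ![1, 1, 2] 0)) ^ (2 * d * d₂) * algebraMap Q _ κ :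
        ↥(cobordantAlgebra (![s₂, Y₂, s] : Fin 3 → Q) ![1, 1, 2])) : Q[T;T⁻¹]) =
      LaurentPolynomial.C ((∏ i : ZMod p, (Y₂ + (i.val : Q) * (s ^ 2 * Y₀ * s₂))) ^ (2 * d * d₂) * κ) * LaurentPolynomial.T (((d₂ * (d * (2 * p))) : ℕ) : ℤ)) ∧
    (((cobordantAlgebra.u' (![s₂, Y₂, s] : Fin 3 → Q) ![1, 1, 2] 2 ^ (d₂ * (d * (2 * p))) * algebraMap Q _ (Y₀ ^ (d₂ * (d * p)) * κ) :
        ↥(cobordantAlgebra (![s₂, Y₂, s] : Fin 3 → Q) ![1, 1, 2])) : Q[T;T⁻¹]) =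
      LaurentPolynomial.C (s ^ (d₂ * (d * (2 * p))) * (Y₀ ^ (d₂ * (d * p)) * κ)) * LaurentPolynomial.T (((2 * (d₂ * (d * (2 * p)))) : ℕ) : ℤ)) := by
  refine ⟨?_, ?_, ?_⟩
  · rw [MulMemClass.coe_mul, SubmonoidClass.coe_pow, cobordantAlgebra.coe_u', cobordantAlgebra.coe_algebraMap]
    change (LaurentPolynomial.C s₂ * LaurentPolynomial.T ((1 : ℕ) : ℤ)) ^ (2 * (d * p)) * LaurentPolynomial.C (Y₀ ^ (d * p) * ηinv) = _
    rw [mul_pow, ← map_pow, LaurentPolynomial.T_pow, map_mul (LaurentPolynomial.C) (s₂ ^ (2 * (d * p))),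
      show (((2 * (d * p)) : ℕ) : ℤ) * ((1 : ℕ) : ℤ) = (((2 * (d * p)) : ℕ) : ℤ) by push_cast; ring]
    ring
  · rw [MulMemClass.coe_mul, SubmonoidClass.coe_pow, SubmonoidClass.coe_finsetProd, cobordantAlgebra.coe_algebraMap]
    have hj : ∀ i : ZMod p, ((cobordantAlgebra.u' (![s₂, Y₂, s] : Fin 3 → Q) ![1, 1, 2] 1 +
        algebraMap Q _ ((i.val : Q) * (s ^ 2 * Y₀)) * cobordantAlgebra.u' (![s₂, Y₂, s] : Fin 3 → Q) ![1, 1, 2] 0 :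
        ↥(cobordantAlgebra (![s₂, Y₂, s] : Fin 3 → Q) ![1, 1, 2])) : Q[T;T⁻¹]) =
        LaurentPolynomial.C Y₂ * LaurentPolynomial.T 1 + LaurentPolynomial.C ((i.val : Q) * (s ^ 2 * Y₀)) * (LaurentPolynomial.C s₂ * LaurentPolynomial.T 1) := by
      intro i
      rw [AddMemClass.coe_add, MulMemClass.coe_mul, cobordantAlgebra.coe_u', cobordantAlgebra.coe_u', cobordantAlgebra.coe_algebraMap]
      rfl
    simp_rw [hj]
    rw [← a1m3_norm_T s₂ Y₀ Y₂ s (p := p), mul_pow, ← map_pow, LaurentPolynomial.T_pow, map_mul (LaurentPolynomial.C) _ κ,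
      show (((2 * d * d₂ : ℕ) : ℤ) * (p : ℤ)) = (((d₂ * (d * (2 * p))) : ℕ) : ℤ) by push_cast; ring]
    ring
  · rw [MulMemClass.coe_mul, SubmonoidClass.coe_pow, cobordantAlgebra.coe_u', cobordantAlgebra.coe_algebraMap]
    change (LaurentPolynomial.C s * LaurentPolynomial.T ((2 : ℕ) : ℤ)) ^ (d₂ * (d * (2 * p))) * LaurentPolynomial.C (Y₀ ^ (d₂ * (d * p)) * κ) = _
    rw [mul_pow, ← map_pow, LaurentPolynomial.T_pow, map_mul (LaurentPolynomial.C) (s ^ (d₂ * (d * (2 * p)))),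
      show (((d₂ * (d * (2 * p)) : ℕ) : ℤ) * ((2 : ℕ) : ℤ)) = (((2 * (d₂ * (d * (2 * p)))) : ℕ) : ℤ) by push_cast; ring]
    ring

/-- ★ **`hrad` for move 3**: with `Y₀, η⁻¹, κ` units, the generators `s₂T, Y₂T, sT²` of the irrelevant ideal of `R₃` lie in `√(c₀, c₁, c₂)` for the cover
`c_j = y_jT^{d₃·2D₂}`. [OURS · L1 W4.5c · a1 move 3] -/
theorem a1m3_hrad [NeZero p] (hY₀u : IsUnit Y₀) (hηu : IsUnit ηinv) (hκu : IsUnit κ)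
    (c₀ c₁ c₂ : ↥(cobordantAlgebra (![s₂, Y₂, s] : Fin 3 → Q) ![1, 1, 2]))
    (hc₀ : (c₀ : Q[T;T⁻¹]) = LaurentPolynomial.C ((s₂ ^ (2 * (d * p)) * (Y₀ ^ (d * p) * ηinv)) ^ (2 * d₂ * d₃)) *
      LaurentPolynomial.T (((d₃ * (2 * (d₂ * (d * (2 * p))))) : ℕ) : ℤ))
    (hc₁ : (c₁ : Q[T;T⁻¹]) = LaurentPolynomial.C (((∏ i : ZMod p, (Y₂ + (i.val : Q) * (s ^ 2 * Y₀ * s₂))) ^ (2 * d * d₂) * κ) ^ (2 * d₃)) *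
      LaurentPolynomial.T (((d₃ * (2 * (d₂ * (d * (2 * p))))) : ℕ) : ℤ))
    (hc₂ : (c₂ : Q[T;T⁻¹]) = LaurentPolynomial.C ((s ^ (d₂ * (d * (2 * p))) * (Y₀ ^ (d₂ * (d * p)) * κ)) ^ d₃) *
      LaurentPolynomial.T (((d₃ * (2 * (d₂ * (d * (2 * p))))) : ℕ) : ℤ)) (i : Fin 3) :
    cobordantAlgebra.u' (![s₂, Y₂, s] : Fin 3 → Q) ![1, 1, 2] i ∈ (Ideal.span ({c₀, c₁, c₂} : Set ↥(cobordantAlgebra (![s₂, Y₂, s] : Fin 3 → Q) ![1, 1, 2]))).radical := by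
  set U₀ := cobordantAlgebra.u' (![s₂, Y₂, s] : Fin 3 → Q) ![1, 1, 2] 0 with hU₀def
  set U₁ := cobordantAlgebra.u' (![s₂, Y₂, s] : Fin 3 → Q) ![1, 1, 2] 1 with hU₁def
  set U₂ := cobordantAlgebra.u' (![s₂, Y₂, s] : Fin 3 → Q) ![1, 1, 2] 2 with hU₂def
  obtain ⟨e0, e1, e2⟩ := a1m3_raw_coe s₂ Y₀ Y₂ s ηinv κ (p := p) d d₂
  -- `U₀^{2dp·2d₂d₃} · (Y₀^{dp}η⁻¹)^{2d₂d₃} = c₀`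
  have hU0 : (U₀ ^ (2 * (d * p)) * algebraMap Q _ (Y₀ ^ (d * p) * ηinv)) ^ (2 * d₂ * d₃) = c₀ := by
    refine Subtype.ext ?_
    rw [SubmonoidClass.coe_pow, e0, hc₀, mul_pow, ← map_pow, LaurentPolynomial.T_pow]
    congr 2
    all_goals (push_cast; try ring)
  have hU2 : (U₂ ^ (d₂ * (d * (2 * p))) * algebraMap Q _ (Y₀ ^ (d₂ * (d * p)) * κ)) ^ d₃ = c₂ := by
    refine Subtype.ext ?_
    rw [SubmonoidClass.coe_pow, e2, hc₂, mul_pow, ← map_pow, LaurentPolynomial.T_pow]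
    congr 2
  have hU1 : ((∏ i : ZMod p, (U₁ + algebraMap Q _ ((i.val : Q) * (s ^ 2 * Y₀)) * U₀)) ^ (2 * d * d₂) * algebraMap Q _ κ) ^ (2 * d₃) = c₁ := by
    refine Subtype.ext ?_
    rw [SubmonoidClass.coe_pow, e1, hc₁, mul_pow, ← map_pow, LaurentPolynomial.T_pow]
    congr 2
    all_goals (push_cast; try ring)
  have hunit : ∀ {x : Q} (_ : IsUnit x) {z c : ↥(cobordantAlgebra (![s₂, Y₂, s] : Fin 3 → Q) ![1, 1, 2])}, z * algebraMap Q _ x = c →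
      c ∈ (Ideal.span ({c₀, c₁, c₂} : Set ↥(cobordantAlgebra (![s₂, Y₂, s] : Fin 3 → Q) ![1, 1, 2]))) →
      z ∈ (Ideal.span ({c₀, c₁, c₂} : Set ↥(cobordantAlgebra (![s₂, Y₂, s] : Fin 3 → Q) ![1, 1, 2]))) := by
    intro x hx z c hzc hc
    obtain ⟨u, hu⟩ := hx.map (algebraMap Q ↥(cobordantAlgebra (![s₂, Y₂, s] : Fin 3 → Q) ![1, 1, 2]))
    have hz : z = c * ↑u⁻¹ := by rw [← hzc, ← hu, Units.mul_inv_cancel_right]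
    rw [hz]
    exact Ideal.mul_mem_right _ _ hc
  have hc₀mem : c₀ ∈ Ideal.span ({c₀, c₁, c₂} : Set ↥(cobordantAlgebra (![s₂, Y₂, s] : Fin 3 → Q) ![1, 1, 2])) := Ideal.subset_span (by simp)
  have hc₁mem : c₁ ∈ Ideal.span ({c₀, c₁, c₂} : Set ↥(cobordantAlgebra (![s₂, Y₂, s] : Fin 3 → Q) ![1, 1, 2])) := Ideal.subset_span (by simp)
  have hc₂mem : c₂ ∈ Ideal.span ({c₀, c₁, c₂} : Set ↥(cobordantAlgebra (![s₂, Y₂, s] : Fin 3 → Q) ![1, 1, 2])) := Ideal.subset_span (by simp)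
  have hU0rad : U₀ ∈ (Ideal.span ({c₀, c₁, c₂} : Set ↥(cobordantAlgebra (![s₂, Y₂, s] : Fin 3 → Q) ![1, 1, 2]))).radical := by
    refine ⟨2 * (d * p) * (2 * d₂ * d₃), ?_⟩
    have hx : IsUnit ((Y₀ ^ (d * p) * ηinv) ^ (2 * d₂ * d₃)) := ((hY₀u.pow _).mul hηu).pow _
    refine hunit hx ?_ hc₀mem
    rw [pow_mul, map_pow, ← mul_pow, hU0]
  have hU2rad : U₂ ∈ (Ideal.span ({c₀, c₁, c₂} : Set ↥(cobordantAlgebra (![s₂, Y₂, s] : Fin 3 → Q) ![1, 1, 2]))).radical := by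
    refine ⟨d₂ * (d * (2 * p)) * d₃, ?_⟩
    have hx : IsUnit ((Y₀ ^ (d₂ * (d * p)) * κ) ^ d₃) := ((hY₀u.pow _).mul hκu).pow _
    refine hunit hx ?_ hc₂mem
    rw [pow_mul, map_pow, ← mul_pow, hU2]
  fin_cases i
  · exact hU0rad
  · change U₁ ∈ _
    have hP : (∏ i : ZMod p, (U₁ + algebraMap Q _ ((i.val : Q) * (s ^ 2 * Y₀)) * U₀)) ∈
        (Ideal.span ({c₀, c₁, c₂} : Set ↥(cobordantAlgebra (![s₂, Y₂, s] : Fin 3 → Q) ![1, 1, 2]))).radical := by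
      refine ⟨2 * d * d₂ * (2 * d₃), ?_⟩
      have hx : IsUnit (κ ^ (2 * d₃)) := hκu.pow _
      refine hunit hx ?_ hc₁mem
      rw [pow_mul, map_pow, ← mul_pow, hU1]
    have hdiff : (∏ i : ZMod p, (U₁ + algebraMap Q _ ((i.val : Q) * (s ^ 2 * Y₀)) * U₀)) - U₁ ^ p ∈ Ideal.span {U₀} :=
      prod_add_mul_sub_pow_mem U₁ U₀ fun i => algebraMap Q _ ((i.val : Q) * (s ^ 2 * Y₀))
    have hYp : U₁ ^ p ∈ (Ideal.span ({c₀, c₁, c₂} : Set ↥(cobordantAlgebra (![s₂, Y₂, s] : Fin 3 → Q) ![1, 1, 2]))).radical := by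
      have h2 := (Ideal.span_singleton_le_iff_mem _ |>.mpr hU0rad) hdiff
      have := sub_mem hP h2
      rwa [sub_sub_cancel] at this
    exact Ideal.mem_radical_of_pow_mem hYp
  · exact hU2rad

/-- ★ **Every cover element of move 3 lies in any ideal containing the three one-row certificates** `s₂T·Y₀`, `X₁·Y₂T`, `Y₀·sT²` (`X₁` a unit) —
in particular in the residual ideal `𝔞₃` (✓`a1m3_residual_mem`): all three producer charts of move 3 are KILLED. [OURS · L1 W4.5c · X-CERT v1 §3 a1] -/
theorem a1m3_cover_mem_ideal [NeZero p] (hX₁u : IsUnit X₁) (hdp : 0 < d * p) (hd₂ : 0 < d₂) (hd₃ : 0 < d₃)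
    (𝔞 : Ideal ↥(cobordantAlgebra (![s₂, Y₂, s] : Fin 3 → Q) ![1, 1, 2]))
    (h₀ : cobordantAlgebra.u' (![s₂, Y₂, s] : Fin 3 → Q) ![1, 1, 2] 0 * algebraMap Q _ Y₀ ∈ 𝔞)
    (h₁ : algebraMap Q _ X₁ * cobordantAlgebra.u' (![s₂, Y₂, s] : Fin 3 → Q) ![1, 1, 2] 1 ∈ 𝔞)
    (h₂ : algebraMap Q _ Y₀ * cobordantAlgebra.u' (![s₂, Y₂, s] : Fin 3 → Q) ![1, 1, 2] 2 ∈ 𝔞)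
    (c₀ c₁ c₂ : ↥(cobordantAlgebra (![s₂, Y₂, s] : Fin 3 → Q) ![1, 1, 2]))
    (hc₀ : (c₀ : Q[T;T⁻¹]) = LaurentPolynomial.C ((s₂ ^ (2 * (d * p)) * (Y₀ ^ (d * p) * ηinv)) ^ (2 * d₂ * d₃)) *
      LaurentPolynomial.T (((d₃ * (2 * (d₂ * (d * (2 * p))))) : ℕ) : ℤ))
    (hc₁ : (c₁ : Q[T;T⁻¹]) = LaurentPolynomial.C (((∏ i : ZMod p, (Y₂ + (i.val : Q) * (s ^ 2 * Y₀ * s₂))) ^ (2 * d * d₂) * κ) ^ (2 * d₃)) *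
      LaurentPolynomial.T (((d₃ * (2 * (d₂ * (d * (2 * p))))) : ℕ) : ℤ))
    (hc₂ : (c₂ : Q[T;T⁻¹]) = LaurentPolynomial.C ((s ^ (d₂ * (d * (2 * p))) * (Y₀ ^ (d₂ * (d * p)) * κ)) ^ d₃) *
      LaurentPolynomial.T (((d₃ * (2 * (d₂ * (d * (2 * p))))) : ℕ) : ℤ)) :
    c₀ ∈ 𝔞 ∧ c₁ ∈ 𝔞 ∧ c₂ ∈ 𝔞 := by
  set U₀ := cobordantAlgebra.u' (![s₂, Y₂, s] : Fin 3 → Q) ![1, 1, 2] 0 with hU₀def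
  set U₁ := cobordantAlgebra.u' (![s₂, Y₂, s] : Fin 3 → Q) ![1, 1, 2] 1 with hU₁def
  set U₂ := cobordantAlgebra.u' (![s₂, Y₂, s] : Fin 3 → Q) ![1, 1, 2] 2 with hU₂def
  obtain ⟨e0, e1, e2⟩ := a1m3_raw_coe s₂ Y₀ Y₂ s ηinv κ (p := p) d d₂
  have hU0 : (U₀ ^ (2 * (d * p)) * algebraMap Q _ (Y₀ ^ (d * p) * ηinv)) ^ (2 * d₂ * d₃) = c₀ := by
    refine Subtype.ext ?_
    rw [SubmonoidClass.coe_pow, e0, hc₀, mul_pow, ← map_pow, LaurentPolynomial.T_pow]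
    congr 2
    all_goals (push_cast; try ring)
  have hU2 : (U₂ ^ (d₂ * (d * (2 * p))) * algebraMap Q _ (Y₀ ^ (d₂ * (d * p)) * κ)) ^ d₃ = c₂ := by
    refine Subtype.ext ?_
    rw [SubmonoidClass.coe_pow, e2, hc₂, mul_pow, ← map_pow, LaurentPolynomial.T_pow]
    congr 2
  have hU1 : ((∏ i : ZMod p, (U₁ + algebraMap Q _ ((i.val : Q) * (s ^ 2 * Y₀)) * U₀)) ^ (2 * d * d₂) * algebraMap Q _ κ) ^ (2 * d₃) = c₁ := by
    refine Subtype.ext ?_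
    rw [SubmonoidClass.coe_pow, e1, hc₁, mul_pow, ← map_pow, LaurentPolynomial.T_pow]
    congr 2
    all_goals (push_cast; try ring)
  -- the raw elements contain a certificate as a factor
  have hb0 : U₀ ^ (2 * (d * p)) * algebraMap Q _ (Y₀ ^ (d * p) * ηinv) ∈ 𝔞 := by
    obtain ⟨a, ha⟩ := Nat.exists_eq_succ_of_ne_zero (Nat.mul_pos two_pos hdp).ne'
    obtain ⟨b, hb⟩ := Nat.exists_eq_succ_of_ne_zero hdp.ne'
    rw [ha, hb, pow_succ, map_mul, map_pow, pow_succ,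
      show U₀ ^ a * U₀ * ((algebraMap Q ↥(cobordantAlgebra (![s₂, Y₂, s] : Fin 3 → Q) ![1, 1, 2])) Y₀ ^ b * (algebraMap Q _) Y₀ * (algebraMap Q _) ηinv) =
        (U₀ * algebraMap Q _ Y₀) * (U₀ ^ a * (algebraMap Q _) Y₀ ^ b * (algebraMap Q _) ηinv) by ring]
    exact Ideal.mul_mem_right _ _ h₀
  have hb2 : U₂ ^ (d₂ * (d * (2 * p))) * algebraMap Q _ (Y₀ ^ (d₂ * (d * p)) * κ) ∈ 𝔞 := by
    obtain ⟨a, ha⟩ := Nat.exists_eq_succ_of_ne_zero (Nat.mul_pos hd₂ (Nat.mul_pos (Nat.pos_of_mul_pos_right hdp) (Nat.mul_pos two_pos (Nat.pos_of_mul_pos_left hdp)))).ne'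
    obtain ⟨b, hb⟩ := Nat.exists_eq_succ_of_ne_zero (Nat.mul_pos hd₂ hdp).ne'
    rw [ha, hb, pow_succ, map_mul, map_pow, pow_succ,
      show U₂ ^ a * U₂ * ((algebraMap Q ↥(cobordantAlgebra (![s₂, Y₂, s] : Fin 3 → Q) ![1, 1, 2])) Y₀ ^ b * (algebraMap Q _) Y₀ * (algebraMap Q _) κ) =
        (algebraMap Q _ Y₀ * U₂) * (U₂ ^ a * (algebraMap Q _) Y₀ ^ b * (algebraMap Q _) κ) by ring]
    exact Ideal.mul_mem_right _ _ h₂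
  have hfac : ∀ i : ZMod p, U₁ + algebraMap Q _ ((i.val : Q) * (s ^ 2 * Y₀)) * U₀ ∈ 𝔞 := by
    intro i
    obtain ⟨u, hu⟩ := hX₁u.map (algebraMap Q ↥(cobordantAlgebra (![s₂, Y₂, s] : Fin 3 → Q) ![1, 1, 2]))
    have hU₁ : U₁ = ↑u⁻¹ * (algebraMap Q _ X₁ * U₁) := by rw [← hu, ← mul_assoc, Units.inv_mul, one_mul]
    refine add_mem ?_ ?_
    · rw [hU₁]; exact Ideal.mul_mem_left _ _ h₁
    · rw [map_mul, map_mul, show (algebraMap Q ↥(cobordantAlgebra (![s₂, Y₂, s] : Fin 3 → Q) ![1, 1, 2])) (i.val : Q) *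
          ((algebraMap Q _) (s ^ 2) * (algebraMap Q _) Y₀) * U₀ = (algebraMap Q _) (i.val : Q) * (algebraMap Q _) (s ^ 2) * (U₀ * (algebraMap Q _) Y₀) by ring]
      exact Ideal.mul_mem_left _ _ h₀
  have hb1 : (∏ i : ZMod p, (U₁ + algebraMap Q _ ((i.val : Q) * (s ^ 2 * Y₀)) * U₀)) ^ (2 * d * d₂) * algebraMap Q _ κ ∈ 𝔞 := by
    refine Ideal.mul_mem_right _ _ (Ideal.pow_mem_of_mem _ ?_ _ (Nat.mul_pos (Nat.mul_pos two_pos (Nat.pos_of_mul_pos_right hdp)) hd₂))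
    rw [← Finset.mul_prod_erase Finset.univ _ (Finset.mem_univ (0 : ZMod p))]
    exact Ideal.mul_mem_right _ _ (hfac 0)
  refine ⟨?_, ?_, ?_⟩
  · rw [← hU0]; exact Ideal.pow_mem_of_mem _ hb0 _ (Nat.mul_pos (Nat.mul_pos two_pos hd₂) hd₃)
  · rw [← hU1]; exact Ideal.pow_mem_of_mem _ hb1 _ (Nat.mul_pos two_pos hd₃)
  · rw [← hU2]; exact Ideal.pow_mem_of_mem _ hb2 _ hd₃

end Summit.ResolutionOfSingularities.ResolutionOfSingularities.Theorems.WildQuotientResolution.S1.KillCert.A1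

end
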